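import Mathlib
import Summits.NavierStokesRegularity.NavierStokesRegularity.Theorems.EulerZoomLiouvillePowerGaugeEulerLiouvilleCasimirFloor
import Summits.NavierStokesRegularity.NavierStokesRegularity.Theorems.EulerZoomLiouvillePowerGaugeEulerLiouvilleCasimirFloorTransport
import Summits.NavierStokesRegularity.NavierStokesRegularity.Theorems.EulerZoomLiouvillePowerGaugeEulerLiouvilleCasimirFloorEndgame
import Summits.NavierStokesRegularity.NavierStokesRegularity.Theorems.EulerZoomLiouvillePowerGaugeEulerLiouvilleSwirlfreeLedgerDecay
import Summits.NavierStokesRegularity.NavierStokesRegularity.Theorems.EulerZoomLiouvillePowerGaugeEulerLiouvilleSwirlfreeLedgerConfinement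
import Summits.NavierStokesRegularity.NavierStokesRegularity.Theorems.EulerZoomLiouvillePowerGaugeEulerLiouvilleSwirlfreeLedgerEndgame
import HarnessLib.Audit

/-!
# Crux E `PowerGaugeEulerLiouville` (stmt-NavierStokesRegularity-19832), line `casimir-floor`: THE MEMBER-LEVEL STRATUM THEOREM
# classical axisymmetric swirl-free members with drift exponent `κ > (1−ρ)/(2−ρ)` are trivial (K1 ∘ K2 ∘ K3, with L1 for `κ > ½`)

Route `EulerZoomLiouville` (NavierStokesRegularity), crux E.  One-call composition, for the LEAD's skeleton (`Lines/birth.lean`, interim LEAD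
ns-typeII-p2 g10, "widen `IsSwirlFreeDrifting` to `κ > (1−ρ)/(2−ρ)`"), of the landed stubs of line `casimir-floor` (ns-idea-11 g3; width seat
ns-cas-k2 g0): K2 `CasimirFloor.casimirFloor` (the sup-Casimir duality enstrophy floor), K1 `CasimirFloor.ledgerBlobsPersist_of_swirlFreeDriftingWith`
(ledger blobs persist backward), K3 `CasimirFloor.vanishesAE_of_casimirFloor_of_blobsPersist` (floor versus `E`-gauge budget), together with the
sibling line `swirlfree-ledger` (ns-sfl-p1 g2: `SwirlfreeLedger.ledgerEndgame_of_classical` ∘ `…axisLedgerDecay_of_classical` ∘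
`…materialConfinement_of_swirlFreeDrifting`) for the overlap `κ > ½` (where no upper bound `κ < 1` is needed).

THE STATEMENT (`CasimirFloor.ae_eq_zero_of_gauge_of_swirlFreeSlowDrifting`): crux hypotheses verbatim (`0 < ρ ≤ ½`) + `(u, p)` classical Euler on
`(−∞, 0)` with axisymmetric swirl-free slices + a drift bound `‖u(τ, x)‖ ≤ M (−τ)^{−κ}` (`τ < 0`) with ANY exponent `κ > (1−ρ)/(2−ρ)` ⇒ `u = 0` a.e.
on `(−∞,0) × ℝ³`.  (`M ≥ 0` is automatic; if `κ > ½` the `q`-ledger line applies, else `κ < 1` and the Casimir line applies.)  The threshold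
`(1−ρ)/(2−ρ)` is `< ½` for every `ρ > 0` (`= ⅓` at `ρ = ½`): the stratum strictly contains v37–v40's `IsSwirlFreeDrifting` (`κ > ½`).

WHAT THIS IS NOT: not NS regularity, not the crux E — a stratum statement about a hypothetical Euler zoom-limit class; the residue (members that
are not classical axisymmetric swirl-free with such a drift exponent) stays OPEN in the lead skeleton.  [folklore]
-/

noncomputable section

set_option linter.dupNamespace false

open MeasureTheory Set Filter Topology Metric Function
open scoped NNReal ENNReal

namespace Summit.NavierStokesRegularity.NavierStokesRegularity.Theorems.PowerGaugeEulerLiouville.CasimirFloor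

open Literature.Analysis Literature.Analysis.FluidPDE
open Summit.NavierStokesRegularity.NavierStokesRegularity.Theorems.PowerGaugeEulerLiouville.SwirlfreeLedger

variable {u : ℝ → EuclideanSpace ℝ (Fin 3) → EuclideanSpace ℝ (Fin 3)} {p : ℝ → EuclideanSpace ℝ (Fin 3) → ℝ}
  {H : ℝ → EuclideanSpace ℝ (Fin 3) → EuclideanSpace ℝ (Fin 3) →L[ℝ] EuclideanSpace ℝ (Fin 3)} {c : ℝ≥0}

/-- **CLASSICAL AXISYMMETRIC SWIRL-FREE MEMBERS WITH DRIFT EXPONENT `κ > (1−ρ)/(2−ρ)` ARE TRIVIAL.**  Crux hypotheses verbatim (`0 < ρ ≤ ½`,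
suitable weak Euler on the past slab, weak gradient `H`, the power gauges `≤ c`) + classical Euler on `(−∞,0)` with axisymmetric swirl-free
slices + `‖u(τ, x)‖ ≤ M (−τ)^{−κ}` for all `τ < 0`, `x`, with `(1−ρ)/(2−ρ) < κ` ⇒ `u = 0` a.e.  Proof: `κ > ½` — line `swirlfree-ledger`
(`ledgerEndgame_of_classical` fed by `axisLedgerDecay_of_classical` and `materialConfinement_of_swirlFreeDrifting`, `q = (6/(6+ρ)+1)/2`);
`κ ≤ ½` (so `κ < 1`, and `M ≥ 0` from the bound at one point) — line `casimir-floor` (`vanishesAE_of_casimirFloor_of_blobsPersist` fed by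
`casimirFloor` and `ledgerBlobsPersist_of_swirlFreeDriftingWith`). [folklore] -/
theorem ae_eq_zero_of_gauge_of_swirlFreeSlowDrifting {ρ : ℝ} (hρ : 0 < ρ) (hρh : ρ ≤ 1 / 2)
    (hsw : IsSuitableWeakSolutionOn (slab (EuclideanSpace ℝ (Fin 3)) (Iio 0) isOpen_Iio) 0 0 u p)
    (hH : HasWeakSpatialGradientOn (slab (EuclideanSpace ℝ (Fin 3)) (Iio 0) isOpen_Iio) u H)
    (hgauge : ∀ a : ℝ, 0 < a →
      ENNReal.ofReal (a ^ (2 * ρ)) * cknA a (0 : ℝ × EuclideanSpace ℝ (Fin 3)) u +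
          ENNReal.ofReal (a ^ ρ) * cknE a (0 : ℝ × EuclideanSpace ℝ (Fin 3)) H +
        ENNReal.ofReal (a ^ (2 * ρ)) * cknD a (0 : ℝ × EuclideanSpace ℝ (Fin 3)) p ≤ (c : ℝ≥0∞))
    (hcl : IsClassicalEulerSolutionOn (Iio 0) 0 u p)
    (hsym : ∀ τ : ℝ, τ < 0 → IsAxisymmetric (u τ) ∧ HasNoSwirl (u τ))
    {M κ : ℝ} (hκρ : (1 - ρ) / (2 - ρ) < κ)
    (hM : ∀ τ : ℝ, τ < 0 → ∀ x : EuclideanSpace ℝ (Fin 3), ‖u τ x‖ ≤ M * (-τ) ^ (-κ)) :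
    uncurry u =ᵐ[volume.restrict (Iio (0 : ℝ) ×ˢ (univ : Set (EuclideanSpace ℝ (Fin 3))))] 0 := by
  by_cases hκ : 1 / 2 < κ
  · -- the `q`-ledger line (`swirlfree-ledger`), exactly as wired in the lead skeleton v37–v40
    have h6 : 6 / (6 + ρ) < 1 := by
      rw [div_lt_one (by linarith)]
      linarith
    have h0 : 0 < 6 / (6 + ρ) := by positivity
    exact ledgerEndgame_of_classical ρ hρ hρh u p H c ⟨hsw, hH, hgauge⟩ hcl
      ⟨(6 / (6 + ρ) + 1) / 2, by linarith, by linarith,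
        axisLedgerDecay_of_classical ρ hρ hρh u p H c ⟨hsw, hH, hgauge⟩ hcl _ (by linarith) (by linarith),
        materialConfinement_of_swirlFreeDrifting u p ⟨hcl, hsym, M, κ, hκ, hM⟩ _ (by linarith)⟩
  · -- the Casimir line (`casimir-floor`): `κ < 1`, `M ≥ 0`
    have hκ1 : κ < 1 := by linarith
    have hM0 : 0 ≤ M := by
      have h := hM (-1) (by norm_num) 0
      rw [neg_neg, Real.one_rpow, mul_one] at h
      exact (norm_nonneg _).trans h
    exact vanishesAE_of_casimirFloor_of_blobsPersist casimirFloor ρ hρ hρh u p H c ⟨hsw, hH, hgauge⟩ M κ hκρ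
      ⟨hcl, hsym, hM0, hκ1, hM⟩ (ledgerBlobsPersist_of_swirlFreeDriftingWith u p M κ ⟨hcl, hsym, hM0, hκ1, hM⟩)

end Summit.NavierStokesRegularity.NavierStokesRegularity.Theorems.PowerGaugeEulerLiouville.CasimirFloor
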